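import Literature.AlgebraicGeometry.HodgeTheory.ComplexTorusIntegralHodgeClassesLefschetzDecompositionMotivicConstituents
import HarnessLib

/-!
# `dim_ℚ End_Hdg(Hˢ(X, ℚ)) ≥ ⌊min(s, 2g−s)/2⌋ + 1` for a polarized complex torus: Künnemann's idempotents of weight `s` are linearly independent elements of the corner
# `π_s ∘ Bᵍ(X × X) ≅ End_Hdg(Hˢ(X, ℚ))` (Künnemann; Milne §5; Kahn §3.5; Voisin §11.3)

Layer `Literature/AlgebraicGeometry/HodgeTheory`, namespace `Literature.AlgebraicGeometry.HodgeTheory.ComplexTorusCat`; lane `lit-hodgefound` (Track 2 foundations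
library, Layer A1/A4), prover seat `lit-hodgefound-p35` (gen 44, row g44-#5). For a complex torus `X` of dimension `g` with `Θ ∈ NS(X)` non-degenerate, `Θ^{[g]} = D·[pt]`,
`N_s ≠ 0`, Künnemann's idempotents `e_{s,0}, …, e_{s,k}` of p08's algebra `CorrRing` (g43-#6; `s = s₀ + 2k`) and their transposes `e′_{s,i}` (g44-#2) are pairwise orthogonal and
non-zero; p08 identified the `ℚ`-subspace `π_s ∘ Bᵍ(X × X)` of the algebra of Hodge correspondences (`CorrRing.hodgeCornerSubmodule s`: the `u` with `π_s ∘ u = u`) with the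
endomorphism algebra `End_Hdg(Hˢ(X, ℚ))` of the rational Hodge structure `Hˢ(X, ℚ)` (`CorrRing.hodgeCornerSubmoduleEquiv`, `finrank_hodgeCornerSubmodule`; Voisin Lemma 11.41, Kahn
Prop. 3.45). THIS FILE:

* §1 **`le_finrank_hodgeCornerSubmodule`** — `k + 1 ≤ dim_ℚ (π_s ∘ Bᵍ(X × X))` for a complete tower of weight `s = s₀ + 2k ≤ g`, `s₀ ≤ 1` (the `e_{s,i}` are `k + 1` `ℚ`-linearly
  independent elements of the corner: pairwise orthogonal non-zero idempotents are linearly independent), and **`…_of_add_eq`** — the same for the weight `2g − s` through the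
  transposed idempotents `e′_{s,i}` (`π_{2g−s} ∘ e′ = e′`);
* §2 **`le_finrank_endAlg_hodgeStructure`** — ON A POLARIZED COMPLEX TORUS `(X, θ)` OF TYPE `(d₁, …, d_g)`, in particular on every polarized abelian variety:
  **`dim_ℚ End_Hdg(Hˢ(X, ℚ)) ≥ ⌊min(s, 2g−s)/2⌋ + 1`** for every `s ≤ 2g` (towers from `θ`, `N_s ≠ 0` unconditionally; only the ring frame `(f, f′)` in the statement besides
  `θ`). The Lefschetz summands `Lⁱ P^{s−2i}(X) ⊂ Hˢ(X, ℚ)` are sub-Hodge structures and their projectors are `⌊min(s, 2g−s)/2⌋ + 1` linearly independent Hodge endomorphisms.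
  Equality holds when the Hodge group is `Sp_{2g}` (not proved here).

Theorems only: NO definition, NO named fact, no `sorry` (D-0026); no `instance`, no notation. Consumed by name: g43-#6 `isIdempotentElem_inv_smul_…`, `inv_smul_…_mul_of_ne`,
`kunnethIdem_mul_inv_smul_…`, `…_mem_hodgeCorr`; g44-#2 `…_ne_zero`, the transposed family (`isIdempotentElem_…pushforward_swapHom…`, `…_mul_of_ne`, `…_ne_zero`, `…_mem_hodgeCorr`,
`sum_…` through `transpose_kunnethIdem`); p08 `CorrRing.hodgeCornerSubmodule`, `mem_hodgeCornerSubmodule_iff`, `finrank_hodgeCornerSubmodule`, `transpose_mul`, `transpose_kunnethIdem`.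

## The sources, as printed

C. Voisin, *Hodge Theory and Complex Algebraic Geometry I* (2002), §11.3.3 Lemma 11.41 (Hodge classes of Künneth type `(k, l)` on `X × Y` = morphisms of Hodge structures), pp. 286–287.
B. Kahn, *Zeta and L-Functions of Varieties and Motives* (CUP 2020), held `book:kahn2020-zeta-l-functions-varieties-motives`, §3.5.2 Prop. 3.45 (p0052) (`A^d_H(X × X, K)` injects into
`End_K(H^*(X))`), §6.9 Def. 6.28. J. S. Milne, *Lefschetz classes on abelian varieties*, Duke Math. J. 96 (1999), held `paper:doi-10-1215-s0012-7094-99-09620-5`, §5 p. 664 (p0026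
L42–L50). H. Lange, *Abelian Varieties over the Complex Numbers* (2023), held `book:lange1992-complex-abelian-varieties`, §6.3.4 Prop. 6.3.9–6.3.11 (p0317–p0319), §7.3.2 (3) (p0338
L12–L16), §3.6 Thm. 3.6.1.

## References
* [Kunnemann1993] K. Künnemann, A Lefschetz decomposition for Chow motives of abelian schemes, Invent. Math. 113 (1993) 85–102 (not held; through Milne §5 and Murre §7.18).
* [VoisinHodgeI2002] C. Voisin, Hodge Theory and Complex Algebraic Geometry I, CUP 2002 — §11.3.3 Lemma 11.41, pp. 286–287; §7.1.2.
* [Kahn2020] B. Kahn, Zeta and L-Functions of Varieties and Motives, LMS LN 462, CUP 2020 — §3.5.2 Prop. 3.45, §6.9 Def. 6.28, §6.12.2 Cor. 6.42.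
* [Milne1999LefschetzClasses] J. S. Milne, Lefschetz classes on abelian varieties, Duke Math. J. 96 (1999) — §5 p. 664 (p0026 L42–L50), Thm. 5.9.
* [Lange2023AbelianVarietiesComplex] H. Lange, Abelian Varieties over the Complex Numbers, Springer 2023 — §6.3.4 Prop. 6.3.9–6.3.11 (p0317–p0319), §7.3.2 (3) (p0338), §3.6 Thm. 3.6.1.
* [Lam2001FirstCourse] T. Y. Lam, A First Course in Noncommutative Rings, 2nd ed., GTM 131, Springer 2001 — §21 (21.1)–(21.3).
-/

noncomputable section

open CategoryTheory Function MulOpposite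

namespace Literature.AlgebraicGeometry.HodgeTheory

open Literature.AlgebraicGeometry.Motives Literature.AlgebraicGeometry.Motives.HodgeStructure
open Literature.Geometry.Kaehler Literature.Geometry.Kaehler.ComplexTorus
open Literature.LinearAlgebra.Alternating Literature.Analysis.Complex
open Literature.RingTheory.Idempotents

namespace ComplexTorusCat

/-! ## §0 Bookkeeping -/

section Generic

/-- Pairwise orthogonal non-zero idempotents of a `ℚ`-algebra are `ℚ`-linearly independent (multiply a relation by `vᵢ`). [cite: Lam2001FirstCourse, §21 (21.1)–(21.3)] -/
private theorem linearIndependent_of_ortho₅₁ {A : Type*} [Ring A] [Algebra ℚ A] {I : Type*} (v : I → A) (hv : ∀ i, IsIdempotentElem (v i))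
    (hvo : ∀ i j, i ≠ j → v i * v j = 0) (hv0 : ∀ i, v i ≠ 0) : LinearIndependent ℚ v := by
  classical
  rw [linearIndependent_iff']
  intro s c hsum i hi
  have h := congrArg (fun x ↦ v i * x) hsum
  simp only [Finset.mul_sum, mul_smul_comm, mul_zero] at h
  rw [Finset.sum_eq_single i (fun j _ hji ↦ by rw [hvo i j (Ne.symm hji), smul_zero]) (fun hi' ↦ (hi' hi).elim), (hv i).eq] at h
  by_contra hc
  exact hv0 i (by rw [← one_smul ℚ (v i), ← inv_mul_cancel₀ hc, mul_smul, h, smul_zero])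

variable {ι : Type*} [Fintype ι] [DecidableEq ι] {E : Type*} [NormedAddCommGroup E] [NormedSpace ℂ E] (Φ : (ι → ℝ) ≃L[ℝ] E) {g : ℕ} (e : Fin (g + g) ≃ ι)
  (he : orientationSign Φ e = 1) (e' : Fin ((g + g) + (g + g)) ≃ ι ⊕ ι)

/-- `n` pairwise orthogonal non-zero idempotents of p08's algebra lying in `Bᵍ(X × X)` with `π_s ∘ vᵢ = vᵢ` give `n ≤ dim_ℚ (π_s ∘ Bᵍ(X × X))` (they are linearly independent elements of the
finite-dimensional `ℚ`-subspace `hodgeCornerSubmodule s`). [cite: Kahn2020, §3.5.2 Prop. 3.45 and §6.9 Def. 6.28] [cite: Lam2001FirstCourse, §21 (21.1)–(21.3)] -/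
private theorem le_finrank_hodgeCornerSubmodule_aux₅₁ {n : ℕ} (v : Fin n → CorrRing Φ e he e') (hv : ∀ i, IsIdempotentElem (v i)) (hvo : ∀ i j, i ≠ j → v i * v j = 0)
    (hv0 : ∀ i, v i ≠ 0) (hmem : ∀ i, v i ∈ CorrRing.hodgeCorr Φ e he e') {s : ℕ} (hcorner : ∀ i, CorrRing.kunnethIdem Φ e he e' s * v i = v i) :
    n ≤ Module.finrank ℚ (CorrRing.hodgeCornerSubmodule Φ e he e' s) := by
  let w : Fin n → CorrRing.hodgeCornerSubmodule Φ e he e' s := fun i ↦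
    ⟨⟨v i, hmem i⟩, (CorrRing.mem_hodgeCornerSubmodule_iff Φ e he e').2 (hcorner i)⟩
  have hw : LinearIndependent ℚ w :=
    LinearIndependent.of_comp ((CorrRing.hodgeCorr Φ e he e').val.toLinearMap.comp (CorrRing.hodgeCornerSubmodule Φ e he e' s).subtype)
      (by exact linearIndependent_of_ortho₅₁ v hv hvo hv0)
  simpa only [Fintype.card_fin] using hw.fintype_card_le_finrank

end Generic

section Kunnemann

variable (X : ComplexTorusCat) {gX gXX gT : ℕ} (hTX : gXX + gX = gT) (eX : Fin (2 * gX) ≃ X.toIsog.ι) (eXX : Fin (2 * gXX) ≃ (prodObj X X).toIsog.ι)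
  (eT : Fin (2 * gT) ≃ (prodObj X (prodObj X X)).toIsog.ι) (hX0 : 2 * gX + 2 * 0 = 2 * gX) (hgX : gX + gX = 2 * gX) (hcX : 2 * gX + 2 * gX = 2 * gXX)
  (hgXX : gXX + gXX = 2 * gXX) (hgg₂ : gX + gX = gXX) (hN' : 2 * gX + 2 * gXX = 2 * gT) (hgT : gT + gT = 2 * gT)
  (f : Fin (gX + gX) ≃ X.toIsog.ι) (hf : orientationSign X.toIsog.Φ f = 1) (f' : Fin ((gX + gX) + (gX + gX)) ≃ X.toIsog.ι ⊕ X.toIsog.ι)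
  (Θ : neronSeveriGroup X.toIsog.Φ) (D : ℤ) {c₁ bc m₂ d₂ l₁ l₇ l₉ : ℕ} (hbc₁ : bc + 1 = gXX)
  (hl₁ : l₁ + 2 * 1 = 2 * gX) (hl₁' : l₁ + 2 * c₁ = 2 * gXX) (h7 : l₇ + 2 * bc = 2 * gT) (h7' : l₇ + 2 * m₂ = 2 * gXX) (hmX : m₂ + gX = bc)
  (hΛL : m₂ + c₁ = d₂) (h9 : l₉ + 2 * d₂ = 2 * gT) (h9' : l₉ + 2 * gX = 2 * gXX)
  (hnd : ∀ v : X.toIsog.E, v ≠ 0 → ∃ w : X.toIsog.E, (Θ : X.toIsog.E [⋀^Fin 2]→L[ℝ] ℝ) ![v, w] ≠ 0)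

/-! ## §1 The corners `π_s ∘ Bᵍ(X × X)` have dimension at least `⌊s/2⌋ + 1`, resp. `⌊(2g−s)/2⌋ + 1` -/

/-- **`π_{2g−s} ∘ e′_{s,i} = e′_{s,i}`** (`s + t = 2g`): the transpose of `e_{s,i} ∘ π_s = e_{s,i}` (g43-#6), `ᵗ(ab) = ᵗb ᵗa`, `ᵗπ_s = π_{2g−s}` (p08) — the transposed idempotents lie in the
corner of weight `2g − s`. [cite: Lange2023AbelianVarietiesComplex, §6.3.4 Prop. 6.3.10 (p0318) and §6.2.2 p. 304] [cite: Kunnemann1993] -/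
private theorem kunnethIdem_mul_transposed₅₁ (hΘ : nsDivPower X Θ gX = D • pointIntegralHodgeClass X eX) (s₀ k : ℕ) (hk : s₀ + 2 * k ≤ gX + 1) {t : ℕ}
    (hst : (s₀ + 2 * k) + t = gX + gX) (i : Fin (k + 1)) :
    CorrRing.kunnethIdem X.toIsog.Φ f hf f' t *
        (lefschetzFamilyConstant gX D s₀ k : ℚ)⁻¹ • integralHodgeClassesCorrRingHom X hTX eX eXX eT hX0 hgX hcX hgXX hgg₂ hN' hgT f hf f'
          (integralHodgeClassesPushforward gX gX (swapHom X X) eXX eXX hcX hgXX hcX hgXX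
            (lefschetzFamily X eX eXX eT hX0 hgX hcX hgXX hgT hN' hgg₂ Θ D hbc₁ hl₁ hl₁' h7 h7' hmX hΛL h9 h9' s₀ k hk i)) =
      (lefschetzFamilyConstant gX D s₀ k : ℚ)⁻¹ • integralHodgeClassesCorrRingHom X hTX eX eXX eT hX0 hgX hcX hgXX hgg₂ hN' hgT f hf f'
          (integralHodgeClassesPushforward gX gX (swapHom X X) eXX eXX hcX hgXX hcX hgXX
            (lefschetzFamily X eX eXX eT hX0 hgX hcX hgXX hgT hN' hgg₂ Θ D hbc₁ hl₁ hl₁' h7 h7' hmX hΛL h9 h9' s₀ k hk i)) := by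
  rw [inv_smul_integralHodgeClassesCorrRingHom_pushforward_swapHom_lefschetzFamily, ← CorrRing.transpose_kunnethIdem X.toIsog.Φ f hf f' _ _ hst, ← CorrRing.transpose_mul,
    inv_smul_integralHodgeClassesCorrRingHom_lefschetzFamily_mul_kunnethIdem X hTX eX eXX eT hX0 hgX hcX hgXX hgg₂ hN' hgT f hf f' Θ D hbc₁ hl₁ hl₁' h7 h7' hmX hΛL h9 h9' hΘ s₀ k hk i]

include hTX eX eXX eT hX0 hgX hcX hgXX hgg₂ hN' hgT Θ D hbc₁ hl₁ hl₁' h7 h7' hmX hΛL h9 h9' hnd in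
/-- **`dim_ℚ (π_s ∘ Bᵍ(X × X)) ≥ ⌊s/2⌋ + 1`** for a complete tower of weight `s = s₀ + 2k ≤ g`, `s₀ ≤ 1`, `N_s ≠ 0`: Künnemann's `e_{s,0}, …, e_{s,k}` are `k + 1` linearly independent
elements of the weight-`s` corner (`π_s ∘ e_{s,i} = e_{s,i}`, g43-#6). [cite: Milne1999LefschetzClasses, §5 p. 664 (p0026 L42–L50)] [cite: Kahn2020, §6.9 Def. 6.28 and §3.5.2 Prop. 3.45] [cite: Kunnemann1993] -/
theorem le_finrank_hodgeCornerSubmodule (hΘ : nsDivPower X Θ gX = D • pointIntegralHodgeClass X eX) (s₀ k : ℕ) (hk : s₀ + 2 * k ≤ gX + 1) (hs : s₀ + 2 * k ≤ gX) (hs₀ : s₀ ≤ 1)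
    (hN : lefschetzFamilyConstant gX D s₀ k ≠ 0) : k + 1 ≤ Module.finrank ℚ (CorrRing.hodgeCornerSubmodule X.toIsog.Φ f hf f' (s₀ + 2 * k)) :=
  le_finrank_hodgeCornerSubmodule_aux₅₁ X.toIsog.Φ f hf f' _
    (fun i ↦ isIdempotentElem_inv_smul_integralHodgeClassesCorrRingHom_lefschetzFamily X hTX eX eXX eT hX0 hgX hcX hgXX hgg₂ hN' hgT f hf f' Θ D hbc₁ hl₁ hl₁' h7 h7' hmX hΛL h9
      h9' hΘ s₀ k hk hN i)
    (fun _ _ hij ↦ inv_smul_integralHodgeClassesCorrRingHom_lefschetzFamily_mul_of_ne X hTX eX eXX eT hX0 hgX hcX hgXX hgg₂ hN' hgT f hf f' Θ D hbc₁ hl₁ hl₁' h7 h7' hmX hΛL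
      h9 h9' hΘ s₀ k hk hij)
    (fun i ↦ inv_smul_integralHodgeClassesCorrRingHom_lefschetzFamily_ne_zero X hTX eX eXX eT hX0 hgX hcX hgXX hgg₂ hN' hgT f hf f' Θ D hbc₁ hl₁ hl₁' h7 h7' hmX hΛL h9 h9' hnd
      hΘ s₀ k hk hs hN i (Or.inr hs₀))
    (fun i ↦ inv_smul_integralHodgeClassesCorrRingHom_lefschetzFamily_mem_hodgeCorr X hTX eX eXX eT hX0 hgX hcX hgXX hgg₂ hN' hgT f hf f' Θ D hbc₁ hl₁ hl₁' h7 h7' hmX hΛL h9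
      h9' s₀ k hk i)
    (fun i ↦ kunnethIdem_mul_inv_smul_integralHodgeClassesCorrRingHom_lefschetzFamily X hTX eX eXX eT hX0 hgX hcX hgXX hgg₂ hN' hgT f hf f' Θ D hbc₁ hl₁ hl₁' h7 h7' hmX hΛL h9 h9'
      hΘ s₀ k hk i)

include hTX eX eXX eT hX0 hgX hcX hgXX hgg₂ hN' hgT Θ D hbc₁ hl₁ hl₁' h7 h7' hmX hΛL h9 h9' hnd in
/-- **`dim_ℚ (π_{2g−s} ∘ Bᵍ(X × X)) ≥ ⌊s/2⌋ + 1`** (`s + t = 2g`, complete tower of weight `s ≤ g`): the transposed idempotents `e′_{s,0}, …, e′_{s,k}` (g44-#2) are `k + 1` linearly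
independent elements of the weight-`t` corner. [cite: Milne1999LefschetzClasses, §5 p. 664 (p0026 L42–L50)] [cite: Lange2023AbelianVarietiesComplex, §6.3.4 Prop. 6.3.10 (p0318)]
[cite: Kahn2020, §6.9 Def. 6.28 and §3.5.2 Prop. 3.45] [cite: Kunnemann1993] -/
theorem le_finrank_hodgeCornerSubmodule_of_add_eq (hΘ : nsDivPower X Θ gX = D • pointIntegralHodgeClass X eX) (s₀ k : ℕ) (hk : s₀ + 2 * k ≤ gX + 1) (hs : s₀ + 2 * k ≤ gX)
    (hs₀ : s₀ ≤ 1) (hN : lefschetzFamilyConstant gX D s₀ k ≠ 0) {t : ℕ} (hst : (s₀ + 2 * k) + t = gX + gX) :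
    k + 1 ≤ Module.finrank ℚ (CorrRing.hodgeCornerSubmodule X.toIsog.Φ f hf f' t) :=
  le_finrank_hodgeCornerSubmodule_aux₅₁ X.toIsog.Φ f hf f' _
    (fun i ↦ isIdempotentElem_inv_smul_integralHodgeClassesCorrRingHom_pushforward_swapHom_lefschetzFamily X hTX eX eXX eT hX0 hgX hcX hgXX hgg₂ hN' hgT f hf f' Θ D hbc₁ hl₁
      hl₁' h7 h7' hmX hΛL h9 h9' hΘ s₀ k hk hN i)
    (fun _ _ hij ↦ inv_smul_integralHodgeClassesCorrRingHom_pushforward_swapHom_lefschetzFamily_mul_of_ne X hTX eX eXX eT hX0 hgX hcX hgXX hgg₂ hN' hgT f hf f' Θ D hbc₁ hl₁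
      hl₁' h7 h7' hmX hΛL h9 h9' hΘ s₀ k hk hij)
    (fun i ↦ inv_smul_integralHodgeClassesCorrRingHom_pushforward_swapHom_lefschetzFamily_ne_zero X hTX eX eXX eT hX0 hgX hcX hgXX hgg₂ hN' hgT f hf f' Θ D hbc₁ hl₁ hl₁' h7
      h7' hmX hΛL h9 h9' hnd hΘ s₀ k hk hs hN i (Or.inr hs₀))
    (fun i ↦ inv_smul_integralHodgeClassesCorrRingHom_pushforward_swapHom_lefschetzFamily_mem_hodgeCorr X hTX eX eXX eT hX0 hgX hcX hgXX hgg₂ hN' hgT f hf f' Θ D hbc₁ hl₁ hl₁'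
      h7 h7' hmX hΛL h9 h9' s₀ k hk i)
    (fun i ↦ kunnethIdem_mul_transposed₅₁ X hTX eX eXX eT hX0 hgX hcX hgXX hgg₂ hN' hgT f hf f' Θ D hbc₁ hl₁ hl₁' h7 h7' hmX hΛL h9 h9' hΘ s₀ k hk hst i)

end Kunnemann

/-! ## §2 `dim_ℚ End_Hdg(Hˢ(X, ℚ)) ≥ ⌊min(s, 2g−s)/2⌋ + 1` on a polarized complex torus of type `(d₁, …, d_g)` -/

section Polarized

/-- The Tower's codegrees for the frames `X × X`, `X × (X × X)` built from the ring frame (`g = b + 1`), with `hTX`. [folklore] -/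
private theorem tower_degrees₅₁ {gX b : ℕ} (hb : gX = b + 1) :
    (gX + gX) + gX = gX + (gX + gX) ∧ 2 * gX + 2 * 0 = 2 * gX ∧ gX + gX = 2 * gX ∧ 2 * gX + 2 * gX = 2 * (gX + gX) ∧ (gX + gX) + (gX + gX) = 2 * (gX + gX) ∧
      gX + gX = gX + gX ∧ 2 * gX + 2 * (gX + gX) = 2 * (gX + (gX + gX)) ∧ (gX + (gX + gX)) + (gX + (gX + gX)) = 2 * (gX + (gX + gX)) ∧
      (gX + b) + 1 = gX + gX ∧ 2 * b + 2 * 1 = 2 * gX ∧ 2 * b + 2 * (gX + 1) = 2 * (gX + gX) ∧ (2 * gX + 2) + 2 * (gX + b) = 2 * (gX + (gX + gX)) ∧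
      (2 * gX + 2) + 2 * b = 2 * (gX + gX) ∧ b + gX = gX + b ∧ b + (gX + 1) = gX + b + 1 ∧ 2 * gX + 2 * (gX + b + 1) = 2 * (gX + (gX + gX)) ∧
      2 * gX + 2 * gX = 2 * (gX + gX) := by
  omega

variable (X : ComplexTorusCat) {gX : ℕ} (f : Fin (gX + gX) ≃ X.toIsog.ι) (hf : orientationSign X.toIsog.Φ f = 1) (f' : Fin ((gX + gX) + (gX + gX)) ≃ X.toIsog.ι ⊕ X.toIsog.ι)
  {θ : neronSeveriGroup X.toIsog.Φ} (hθ : IsRiemannForm X.toIsog.Φ (θ : X.toIsog.E [⋀^Fin 2]→L[ℝ] ℝ))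
  {dd : Fin gX → ℕ} (hd : IsPolarizationType X.toIsog.Φ (θ : X.toIsog.E [⋀^Fin 2]→L[ℝ] ℝ) dd)

include hθ hd in
/-- `(−1)^g d₁⋯d_g ≠ 0` for a polarization of type `(d₁, …, d_g)`. [cite: Lange2023AbelianVarietiesComplex, §3.6 Thm. 3.6.1] -/
private theorem neg_one_pow_mul_prod_ne_zero₅₁ : ((-1 : ℤ) ^ gX * ∏ j, (dd j : ℤ)) ≠ 0 :=
  mul_ne_zero (pow_ne_zero _ (by norm_num)) (Finset.prod_ne_zero_iff.2 fun j _ ↦ Int.natCast_ne_zero.2 (hd.pos hθ j).ne')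

include hθ hd in
/-- **`dim_ℚ (π_s ∘ Bᵍ(X × X)) ≥ ⌊min(s, 2g−s)/2⌋ + 1` FOR EVERY WEIGHT `s ≤ 2g`** on a polarized complex torus of type `(d₁, …, d_g)` (§1 on the complete tower of weight `min(s, 2g−s)`
built from `θ`; `g = 0`: the corner of weight `0` contains `π_0 ≠ 0`). [cite: Milne1999LefschetzClasses, §5 p. 664 (p0026 L42–L50)] [cite: Kahn2020, §6.9 Def. 6.28 and §3.5.2 Prop. 3.45]
[cite: Lange2023AbelianVarietiesComplex, §3.6 Thm. 3.6.1 and §6.3.4 Prop. 6.3.9–6.3.10] [cite: Kunnemann1993] -/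
theorem le_finrank_hodgeCornerSubmodule_of_isPolarizationType {s : ℕ} (hs : s ≤ gX + gX) :
    min s (gX + gX - s) / 2 + 1 ≤ Module.finrank ℚ (CorrRing.hodgeCornerSubmodule X.toIsog.Φ f hf f' s) := by
  -- the degenerate torus `g = 0`: `s = 0` and `π_0 ≠ 0` lies in the corner
  rcases Nat.eq_zero_or_pos gX with hg0 | hg0
  · subst hg0
    obtain rfl : s = 0 := by omega
    refine Module.finrank_pos_iff_exists_ne_zero.2 ⟨⟨CorrRing.hodgeKunnethIdem X.toIsog.Φ f hf f' 0,
      (CorrRing.mem_hodgeCornerSubmodule_iff X.toIsog.Φ f hf f').2 (CorrRing.isIdempotentElem_kunnethIdem X.toIsog.Φ f hf f' 0).eq⟩, fun h ↦ ?_⟩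
    have h1 := congrArg (fun x : CorrRing.hodgeCornerSubmodule X.toIsog.Φ f hf f' 0 ↦ ((x : CorrRing.hodgeCorr X.toIsog.Φ f hf f') : CorrRing X.toIsog.Φ f hf f')) h
    simp only [ZeroMemClass.coe_zero, CorrRing.coe_hodgeKunnethIdem] at h1
    exact CorrRing.kunnethIdem_ne_zero X.toIsog.Φ f hf f' ⟨0, by omega⟩ h1
  obtain ⟨b, hb⟩ : ∃ b, gX = b + 1 := ⟨gX - 1, by omega⟩
  obtain ⟨hTX, hX0, hgX, hcX, hgXX, hgg₂, hN', hgT, hbc₁, hl₁, hl₁', h7, h7', hmX, hΛL, h9, h9'⟩ := tower_degrees₅₁ hb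
  let eX : Fin (2 * gX) ≃ X.toIsog.ι := (finCongr (two_mul gX)).trans f
  let eXX : Fin (2 * (gX + gX)) ≃ (prodObj X X).toIsog.ι := (finCongr hcX.symm).trans (finSumFinEquiv.symm.trans (eX.sumCongr eX))
  let eT : Fin (2 * (gX + (gX + gX))) ≃ (prodObj X (prodObj X X)).toIsog.ι := (finCongr hN'.symm).trans (finSumFinEquiv.symm.trans (eX.sumCongr eXX))
  have hnd := IsRiemannForm.exists_apply_ne_zero X.toIsog.Φ hθ
  have hΘ := nsDivPower_top_eq_zsmul_pointIntegralHodgeClass X eX hθ hd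
  have hD := neg_one_pow_mul_prod_ne_zero₅₁ X hθ hd
  rcases Nat.lt_or_ge gX s with hgs | hgs
  · -- above the middle: the transposed tower of weight `2g − s`
    rw [min_eq_right (by omega)]
    exact le_finrank_hodgeCornerSubmodule_of_add_eq X hTX eX eXX eT hX0 hgX hcX hgXX hgg₂ hN' hgT f hf f' θ _ hbc₁ hl₁ hl₁' h7 h7' hmX hΛL h9 h9' hnd hΘ ((gX + gX - s) % 2)
      ((gX + gX - s) / 2) (by omega) (by omega) (by omega) (lefschetzFamilyConstant_ne_zero hD _ _ (by omega)) (t := s) (by omega)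
  · -- below the middle: the tower of weight `s`
    rw [min_eq_left (by omega)]
    have hs' : s % 2 + 2 * (s / 2) = s := Nat.mod_add_div _ _
    have h := le_finrank_hodgeCornerSubmodule X hTX eX eXX eT hX0 hgX hcX hgXX hgg₂ hN' hgT f hf f' θ _ hbc₁ hl₁ hl₁' h7 h7' hmX hΛL h9 h9' hnd hΘ (s % 2) (s / 2) (by omega)
      (by omega) (by omega) (lefschetzFamilyConstant_ne_zero hD _ _ (by omega))
    rwa [hs'] at h

include f hf f' hθ hd in
/-- **ON A POLARIZED COMPLEX TORUS `(X, θ)` OF TYPE `(d₁, …, d_g)` — IN PARTICULAR ON EVERY POLARIZED ABELIAN VARIETY: `dim_ℚ End_Hdg(Hˢ(X, ℚ)) ≥ ⌊min(s, 2g−s)/2⌋ + 1`** for every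
`s ≤ 2g` (p08's `π_s ∘ Bᵍ(X × X) ≃ₗ[ℚ] End_Hdg(Hˢ(X, ℚ))`, `finrank_hodgeCornerSubmodule`, and the weight-wise bound): the projectors onto the Lefschetz summands `Lⁱ P^{s−2i}(X)`,
`2i ≤ min(s, 2g−s)`, are that many linearly independent endomorphisms of the rational Hodge structure `Hˢ(X, ℚ)`. [cite: VoisinHodgeI2002, §11.3.3 Lemma 11.41 and pp. 286–287]
[cite: Kahn2020, §3.5.2 Prop. 3.45 and §6.9 Def. 6.28] [cite: Milne1999LefschetzClasses, §5 p. 664 (p0026 L42–L50)] [cite: Lange2023AbelianVarietiesComplex, §3.6 Thm. 3.6.1 and §7.3.2 (3) (p0338 L12–L16)]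
[cite: Kunnemann1993] -/
theorem le_finrank_endAlg_hodgeStructure (s : Fin (gX + gX + 1)) :
    min (s : ℕ) (gX + gX - s) / 2 + 1 ≤ Module.finrank ℚ (hodgeStructure X.toIsog.Φ (s : ℕ)).endAlg := by
  rw [← CorrRing.finrank_hodgeCornerSubmodule X.toIsog.Φ f hf f' s]
  exact le_finrank_hodgeCornerSubmodule_of_isPolarizationType X f hf f' hθ hd (Nat.le_of_lt_succ s.2)

end Polarized

end ComplexTorusCat

end Literature.AlgebraicGeometry.HodgeTheory

end
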